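import Summits.SmoothPoincare4.SmoothPoincare4.Theorems.ConvexBisectionAcyclicBisectionExistsHgapTwistFraming
import Summits.SmoothPoincare4.SmoothPoincare4.Theorems.ConvexBisectionAcyclicBisectionExistsHgapCharacterSign
import Literature.Topology.FourManifolds.CircleTubeTransition
import HarnessLib

/-!
# Hgap ▸ part B (page twisting of the straightened dual framed knot), brick G2-3 (sphere side, I):
# the three-dimensional belt-tube chart, its injective differential and its orientation character
(wave 6, crux stmt-SmoothPoincare4-10508, line `modp-braid-orbits`, stub `stub_T3_dualPresentation` (T3)
▸ node `Hgap` ▸ part B `helper_Hgap_twisting`; registered sub-goal `helper_det4_beltChart_ne_zero`)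

The TRANSFER step G2-3 (`G2-REPORT.md` §4 (R6a)) needs the belt-tube chart of the `j`-th handle pushed
through the seam and a boundary self-diffeomorphism `E` of the base (the time-1 map of the straightening)
as a map of THREE real variables `p = (m₀, m₁, φ)`:
`Γ̂ (p) = (E (seam (β♭ (e^{2πiφ}, m)))).1 ∈ ℝ⁴`, `β♭ = (beltMap D j).boundaryTube`.  This file proves:

* §1 the source map `p ↦ (e^{2πiφ}, m)` into `S¹ × ℝ²` is smooth with injective differential
  (`hasMFDerivAt_chartSrc`, `injective_chartSrcDeriv`);
* §2 `Γ̂` is smooth on `{‖m‖ < 1}` with INJECTIVE differential (`hasMFDerivAt_beltChart₃`,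
  `injective_mfderiv_beltChart₃`: every factor is an immersion — the tube, the seam diffeomorphism, `E`,
  the inclusion `Base g ↪ ℝ⁴`);
* §3 its values are boundary points and its differential is tangent to `∂ Base g`
  (`rho_beltChart₃`, `fderiv_rho_beltChart₃`), hence **the orientation character
  `χ (p) = det4 (∇rho (Γ̂ p), ∂₀Γ̂, ∂₁Γ̂, ∂_φΓ̂)` never vanishes** on the chart (`det4_beltChart₃_ne_zero`,
  registered `helper_det4_beltChart_ne_zero`; X4 `det4_ne_zero_of_normal_frame`).

With the continuity of `χ` along the radial segments (sequel file) this pins `sign χ (m, φ) = sign χ (0, φ)`,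
the sphere-side half of `σ̂ = -s₀ ε`.  Everything is proved; no named facts, no `sorry`.  References:
A. A. Kosinski, *Differential Manifolds* (1993), VI §6 [Kosinski1993]; J. M. Lee, *Introduction to Smooth
Manifolds* (2013), Prop. 15.24 [LeeSmoothManifolds2013].
-/

noncomputable section

set_option linter.dupNamespace false

open scoped Manifold ContDiff Topology RealInnerProductSpace
open Set Function Metric
open Literature.Topology.FourManifolds Literature.Topology.FourManifolds.HandleAttachingMap
  Literature.Topology.FourManifolds.LefschetzBase Literature.Geometry.Symplectic

namespace Summit.SmoothPoincare4.SmoothPoincare4.Theorems.AcyclicBisectionExists.ModpBraidOrbits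

/-! ## §1 The source map `(m₀, m₁, φ) ↦ (e^{2πiφ}, m)` -/

/-- The fibre part `p ↦ (p₀, p₁)` of the three-dimensional chart, a continuous linear map `ℝ³ → ℝ²`.
[folklore] -/
theorem exists_lamL3 : ∃ L : EuclideanSpace ℝ (Fin 3) →L[ℝ] EuclideanSpace ℝ (Fin 2),
    ∀ (p : EuclideanSpace ℝ (Fin 3)) (i : Fin 2), L p i = p (Fin.castSucc i) := by
  refine ⟨(EuclideanSpace.equiv (Fin 2) ℝ).symm.toContinuousLinearMap.comp
    (ContinuousLinearMap.pi fun i : Fin 2 => EuclideanSpace.proj (𝕜 := ℝ) (Fin.castSucc i)), fun p i => ?_⟩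
  rfl

/-- **The source map has injective differential**: for the map `ι (p) = (circlePt (p 2), L p)` with `L` the
fibre part, the differential `u ↦ (d(circlePt) (u 2), L u)` is injective (`d(circlePt) ≠ 0`). [folklore] -/
theorem injective_chartSrcDeriv {L : EuclideanSpace ℝ (Fin 3) →L[ℝ] EuclideanSpace ℝ (Fin 2)}
    (hL : ∀ (p : EuclideanSpace ℝ (Fin 3)) (i : Fin 2), L p i = p (Fin.castSucc i)) (φ : ℝ) :
    Injective (fun u : EuclideanSpace ℝ (Fin 3) =>
      (((mfderiv 𝓘(ℝ, ℝ) (𝓡 1) circlePt φ : ℝ →L[ℝ] EuclideanSpace ℝ (Fin 1)) (u 2), L u) :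
        EuclideanSpace ℝ (Fin 1) × EuclideanSpace ℝ (Fin 2))) := by
  set D1 : ℝ →L[ℝ] EuclideanSpace ℝ (Fin 1) := mfderiv 𝓘(ℝ, ℝ) (𝓡 1) circlePt φ with hD1
  intro u v huv
  have h2 : L u = L v := congrArg Prod.snd huv
  have h1 : D1 (u 2) = D1 (v 2) := congrArg Prod.fst huv
  have hu0 : u 0 = v 0 := by have := congrArg (fun w : EuclideanSpace ℝ (Fin 2) => w 0) h2; rwa [hL, hL] at this
  have hu1 : u 1 = v 1 := by have := congrArg (fun w : EuclideanSpace ℝ (Fin 2) => w 1) h2; rwa [hL, hL] at this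
  have hu2 : u 2 = v 2 := by
    have h3 : D1 (u 2 - v 2) = 0 := by rw [map_sub]; exact sub_eq_zero.2 h1
    have h4 := D1.map_smul (u 2 - v 2) (1 : ℝ)
    rw [smul_eq_mul, mul_one, h3] at h4
    rcases smul_eq_zero.1 h4.symm with h | h
    · linarith
    · exact absurd h (mfderiv_circlePt_one_ne_zero φ)
  ext i
  fin_cases i
  · exact hu0
  · exact hu1
  · exact hu2

/-! ## §2 The three-dimensional belt-tube chart and its injective differential -/

section Chart

variable {g : ℕ} {ι : Type} [Finite ι] {h : ι → HandleAttachingMap 3 2 (Base g)}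
  {X : Type} [TopologicalSpace X] [ChartedSpace (EuclideanHalfSpace 4) X] [IsManifold (𝓡∂ 4) ∞ X]
  (D : MultiAttachmentData h (𝓡∂ 4) X) (bX : BoundaryData (𝓡∂ 4) X (𝓡 3))
  (Ψ : bX.carrier ≃ₘ⟮𝓡 3, 𝓡 3⟯ (bBase g).carrier) (E : Base g ≃ₘ^∞⟮𝓡∂ 4, 𝓡∂ 4⟯ Base g) (j : ι)
  {L : EuclideanSpace ℝ (Fin 3) →L[ℝ] EuclideanSpace ℝ (Fin 2)}

/-- **The three-dimensional belt-tube chart has an injective differential** at every point of the chart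
domain `‖L p‖ < 1`: `Γ̂ = val ∘ E ∘ seam ∘ β♭ ∘ ι` with every factor an immersion. [cite: Kosinski1993, VI §6] -/
theorem hasMFDerivAt_beltChart₃
    (hL : ∀ (p : EuclideanSpace ℝ (Fin 3)) (i : Fin 2), L p i = p (Fin.castSucc i))
    (p : EuclideanSpace ℝ (Fin 3)) (hp : ‖L p‖ < 1) :
    ∃ Dp : EuclideanSpace ℝ (Fin 3) →L[ℝ] EuclideanSpace ℝ (Fin 4), Injective Dp ∧
      HasMFDerivAt 𝓘(ℝ, EuclideanSpace ℝ (Fin 3)) 𝓘(ℝ, EuclideanSpace ℝ (Fin 4))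
        (fun p : EuclideanSpace ℝ (Fin 3) => (E ((BoundaryManifold.boundaryData 3 (Base g)).incl
          (seamDiffeo bX (bBase g) Ψ ((beltMap D j).boundaryTube.toHomeo (circlePt (p 2), L p))))).1) p Dp := by
  -- the source map
  set ι₀ : EuclideanSpace ℝ (Fin 3) → (sphere (0 : EuclideanSpace ℝ (Fin 2)) 1) × EuclideanSpace ℝ (Fin 2) :=
    fun p => (circlePt (p 2), L p) with hι₀
  have hcirc : HasMFDerivAt 𝓘(ℝ, ℝ) (𝓡 1) circlePt (p 2) (mfderiv 𝓘(ℝ, ℝ) (𝓡 1) circlePt (p 2)) :=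
    (contMDiff_circlePt.mdifferentiableAt (by simp)).hasMFDerivAt
  have hπ : HasMFDerivAt 𝓘(ℝ, EuclideanSpace ℝ (Fin 3)) 𝓘(ℝ, ℝ) (fun p : EuclideanSpace ℝ (Fin 3) => p 2) p
      (EuclideanSpace.proj (𝕜 := ℝ) (2 : Fin 3)) :=
    (EuclideanSpace.proj (𝕜 := ℝ) (2 : Fin 3)).hasFDerivAt.hasMFDerivAt
  have hLd : HasMFDerivAt 𝓘(ℝ, EuclideanSpace ℝ (Fin 3)) 𝓘(ℝ, EuclideanSpace ℝ (Fin 2)) L p L :=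
    L.hasFDerivAt.hasMFDerivAt
  have hι : HasMFDerivAt 𝓘(ℝ, EuclideanSpace ℝ (Fin 3)) ((𝓡 1).prod 𝓘(ℝ, EuclideanSpace ℝ (Fin 2))) ι₀ p
      (((mfderiv 𝓘(ℝ, ℝ) (𝓡 1) circlePt (p 2)).comp (EuclideanSpace.proj (𝕜 := ℝ) (2 : Fin 3))).prod L) :=
    (hcirc.comp p hπ).prodMk hLd
  -- the tube
  have hsrc : ι₀ p ∈ (beltMap D j).boundaryTube.toHomeo.source := by
    rw [CircleTube.mem_source_iff]; exact hp
  have hβ : HasMFDerivAt ((𝓡 1).prod 𝓘(ℝ, EuclideanSpace ℝ (Fin 2))) (𝓡 3) (beltMap D j).boundaryTube.toHomeo (ι₀ p)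
      (mfderiv ((𝓡 1).prod 𝓘(ℝ, EuclideanSpace ℝ (Fin 2))) (𝓡 3) (beltMap D j).boundaryTube.toHomeo (ι₀ p)) :=
    (((beltMap D j).boundaryTube.contMDiffAt_toHomeo hsrc).mdifferentiableAt (by simp)).hasMFDerivAt
  -- the seam push
  set σ : (BoundaryManifold.boundaryData 3 X).carrier → Base g :=
    fun y => (BoundaryManifold.boundaryData 3 (Base g)).incl (seamDiffeo bX (bBase g) Ψ y) with hσ
  have hσd := hasMFDerivAt_seamPush (seamDiffeo bX (bBase g) Ψ) ((beltMap D j).boundaryTube.toHomeo (ι₀ p))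
  -- the diffeomorphism and the inclusion
  have hE : HasMFDerivAt (𝓡∂ 4) (𝓡∂ 4) E (σ ((beltMap D j).boundaryTube.toHomeo (ι₀ p)))
      (mfderiv (𝓡∂ 4) (𝓡∂ 4) E (σ ((beltMap D j).boundaryTube.toHomeo (ι₀ p)))) :=
    (E.contMDiff.mdifferentiableAt (by simp)).hasMFDerivAt
  have hval := hasMFDerivAt_incl_base (g := g) (E (σ ((beltMap D j).boundaryTube.toHomeo (ι₀ p))))
  have hcomp := hval.comp p (hE.comp p (hσd.comp p (hβ.comp p hι)))
  refine ⟨_, ?_, hcomp⟩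
  -- injectivity, factor by factor
  have i1 : Injective (((mfderiv 𝓘(ℝ, ℝ) (𝓡 1) circlePt (p 2)).comp (EuclideanSpace.proj (𝕜 := ℝ) (2 : Fin 3))).prod L) :=
    fun u v huv => injective_chartSrcDeriv hL (p 2) (by exact huv)
  have i2 := (beltMap D j).boundaryTube.injective_mfderiv_toHomeo hsrc
  have i3 := injective_mfderiv_seamPush (seamDiffeo bX (bBase g) Ψ) ((beltMap D j).boundaryTube.toHomeo (ι₀ p))
  have i4 : Injective (mfderiv (𝓡∂ 4) (𝓡∂ 4) E (σ ((beltMap D j).boundaryTube.toHomeo (ι₀ p)))) :=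
    fun a b hab => (E.mfderivToContinuousLinearEquiv (by simp) (σ ((beltMap D j).boundaryTube.toHomeo (ι₀ p)))).injective hab
  have i5 : Injective (ambientCLM g (E (σ ((beltMap D j).boundaryTube.toHomeo (ι₀ p))))) := injective_ambient _
  rw [(hasMFDerivAt_seamPush (seamDiffeo bX (bBase g) Ψ) _).mfderiv] at i3
  exact i5.comp (i4.comp (i3.comp (i2.comp i1)))

/-- **Injectivity of the differential of the three-dimensional belt-tube chart.** [cite: Kosinski1993, VI §6] -/
theorem injective_mfderiv_beltChart₃
    (hL : ∀ (p : EuclideanSpace ℝ (Fin 3)) (i : Fin 2), L p i = p (Fin.castSucc i))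
    (p : EuclideanSpace ℝ (Fin 3)) (hp : ‖L p‖ < 1) :
    Injective (mfderiv 𝓘(ℝ, EuclideanSpace ℝ (Fin 3)) 𝓘(ℝ, EuclideanSpace ℝ (Fin 4))
      (fun p : EuclideanSpace ℝ (Fin 3) => (E ((BoundaryManifold.boundaryData 3 (Base g)).incl
        (seamDiffeo bX (bBase g) Ψ ((beltMap D j).boundaryTube.toHomeo (circlePt (p 2), L p))))).1) p) := by
  obtain ⟨Dp, hinj, hD⟩ := hasMFDerivAt_beltChart₃ D bX Ψ E j hL p hp
  rw [hD.mfderiv]; exact hinj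

/-! ## §3 Tangency and the non-vanishing orientation character -/

/-- The chart takes boundary values: `rho (Γ̂ p) = 1/4` for a `rho`-preserving `E`. [folklore] -/
theorem rho_beltChart₃ (hEρ : ∀ x : Base g, rho g (E x).1 = rho g x.1) (p : EuclideanSpace ℝ (Fin 3)) :
    rho g (E ((BoundaryManifold.boundaryData 3 (Base g)).incl (seamDiffeo bX (bBase g) Ψ
      ((beltMap D j).boundaryTube.toHomeo (circlePt (p 2), L p))))).1 = 1 / 4 := by
  rw [hEρ]
  exact (RegularSublevel.mem_boundary_iff (isRegularLevel_rho g) _).1 (seamDiffeo bX (bBase g) Ψ _).2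

/-- **The differential of the chart is tangent to the boundary**: `d rho (dΓ̂ u) = 0` (since `rho ∘ Γ̂ ≡ 1/4`).
[folklore] -/
theorem fderiv_rho_beltChart₃
    (hL : ∀ (p : EuclideanSpace ℝ (Fin 3)) (i : Fin 2), L p i = p (Fin.castSucc i))
    (hEρ : ∀ x : Base g, rho g (E x).1 = rho g x.1) (p : EuclideanSpace ℝ (Fin 3)) (hp : ‖L p‖ < 1)
    (u : EuclideanSpace ℝ (Fin 3)) :
    fderiv ℝ (rho g) (E ((BoundaryManifold.boundaryData 3 (Base g)).incl (seamDiffeo bX (bBase g) Ψ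
        ((beltMap D j).boundaryTube.toHomeo (circlePt (p 2), L p))))).1
      (mfderiv 𝓘(ℝ, EuclideanSpace ℝ (Fin 3)) 𝓘(ℝ, EuclideanSpace ℝ (Fin 4))
        (fun p : EuclideanSpace ℝ (Fin 3) => (E ((BoundaryManifold.boundaryData 3 (Base g)).incl
          (seamDiffeo bX (bBase g) Ψ ((beltMap D j).boundaryTube.toHomeo (circlePt (p 2), L p))))).1) p u) = 0 := by
  obtain ⟨Dp, -, hD⟩ := hasMFDerivAt_beltChart₃ D bX Ψ E j hL p hp
  rw [hD.mfderiv]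
  have hF : HasFDerivAt (fun p : EuclideanSpace ℝ (Fin 3) => (E ((BoundaryManifold.boundaryData 3 (Base g)).incl
      (seamDiffeo bX (bBase g) Ψ ((beltMap D j).boundaryTube.toHomeo (circlePt (p 2), L p))))).1) Dp p :=
    hasMFDerivAt_iff_hasFDerivAt.1 hD
  have hρd : HasFDerivAt (rho g) (fderiv ℝ (rho g) (E ((BoundaryManifold.boundaryData 3 (Base g)).incl
      (seamDiffeo bX (bBase g) Ψ ((beltMap D j).boundaryTube.toHomeo (circlePt (p 2), L p))))).1) _ :=
    (((contDiff_rho g).differentiable (by simp)) _).hasFDerivAt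
  have hcomp := hρd.comp p hF
  have hconst : HasFDerivAt (fun p : EuclideanSpace ℝ (Fin 3) => rho g (E ((BoundaryManifold.boundaryData 3 (Base g)).incl
      (seamDiffeo bX (bBase g) Ψ ((beltMap D j).boundaryTube.toHomeo (circlePt (p 2), L p))))).1)
      (0 : EuclideanSpace ℝ (Fin 3) →L[ℝ] ℝ) p := by
    have e : (fun p : EuclideanSpace ℝ (Fin 3) => rho g (E ((BoundaryManifold.boundaryData 3 (Base g)).incl
        (seamDiffeo bX (bBase g) Ψ ((beltMap D j).boundaryTube.toHomeo (circlePt (p 2), L p))))).1) =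
        fun _ => (1 / 4 : ℝ) := funext fun p => rho_beltChart₃ D bX Ψ E j hEρ p
    rw [e]; exact hasFDerivAt_const _ _
  have huniq := hcomp.unique hconst
  have := DFunLike.congr_fun huniq u
  exact this

/-- **The orientation character of the three-dimensional belt-tube chart never vanishes** (brick G2-3, sphere
side I): at every `p` of the chart domain, `det4 (∇rho (Γ̂ p), dΓ̂ e₀, dΓ̂ e₁, dΓ̂ e₂) ≠ 0` — `∇rho ≠ 0` is normal to
the boundary, the three columns are tangent and independent. [cite: LeeSmoothManifolds2013, Prop. 15.24] -/
theorem det4_beltChart₃_ne_zero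
    (hL : ∀ (p : EuclideanSpace ℝ (Fin 3)) (i : Fin 2), L p i = p (Fin.castSucc i))
    (hEρ : ∀ x : Base g, rho g (E x).1 = rho g x.1) (p : EuclideanSpace ℝ (Fin 3)) (hp : ‖L p‖ < 1) :
    det4 (gradient (rho g) (E ((BoundaryManifold.boundaryData 3 (Base g)).incl (seamDiffeo bX (bBase g) Ψ
        ((beltMap D j).boundaryTube.toHomeo (circlePt (p 2), L p))))).1)
      (mfderiv 𝓘(ℝ, EuclideanSpace ℝ (Fin 3)) 𝓘(ℝ, EuclideanSpace ℝ (Fin 4))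
        (fun p : EuclideanSpace ℝ (Fin 3) => (E ((BoundaryManifold.boundaryData 3 (Base g)).incl
          (seamDiffeo bX (bBase g) Ψ ((beltMap D j).boundaryTube.toHomeo (circlePt (p 2), L p))))).1) p
        (EuclideanSpace.single (0 : Fin 3) (1 : ℝ)))
      (mfderiv 𝓘(ℝ, EuclideanSpace ℝ (Fin 3)) 𝓘(ℝ, EuclideanSpace ℝ (Fin 4))
        (fun p : EuclideanSpace ℝ (Fin 3) => (E ((BoundaryManifold.boundaryData 3 (Base g)).incl
          (seamDiffeo bX (bBase g) Ψ ((beltMap D j).boundaryTube.toHomeo (circlePt (p 2), L p))))).1) p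
        (EuclideanSpace.single (1 : Fin 3) (1 : ℝ)))
      (mfderiv 𝓘(ℝ, EuclideanSpace ℝ (Fin 3)) 𝓘(ℝ, EuclideanSpace ℝ (Fin 4))
        (fun p : EuclideanSpace ℝ (Fin 3) => (E ((BoundaryManifold.boundaryData 3 (Base g)).incl
          (seamDiffeo bX (bBase g) Ψ ((beltMap D j).boundaryTube.toHomeo (circlePt (p 2), L p))))).1) p
        (EuclideanSpace.single (2 : Fin 3) (1 : ℝ))) ≠ 0 := by
  obtain ⟨Dp, hinj, hD⟩ := hasMFDerivAt_beltChart₃ D bX Ψ E j hL p hp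
  have hρ := fderiv_rho_beltChart₃ D bX Ψ E j hL hEρ p hp
  rw [hD.mfderiv] at hρ ⊢
  set q := (E ((BoundaryManifold.boundaryData 3 (Base g)).incl (seamDiffeo bX (bBase g) Ψ
    ((beltMap D j).boundaryTube.toHomeo (circlePt (p 2), L p))))) with hq
  have hn : gradient (rho g) q.1 ≠ 0 := gradient_rho_ne_zero q (rho_beltChart₃ D bX Ψ E j hEρ p)
  set V : Fin 3 → EuclideanSpace ℝ (Fin 4) := fun k => Dp (EuclideanSpace.single k (1 : ℝ)) with hV
  have hVn : ∀ k, ⟪gradient (rho g) q.1, V k⟫ = 0 := fun k => by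
    rw [inner_gradient_eq_fderiv]; exact hρ _
  have hli : LinearIndependent ℝ V := by
    have hb : LinearIndependent ℝ (fun k : Fin 3 => EuclideanSpace.single k (1 : ℝ)) := by
      have h0 := (EuclideanSpace.basisFun (Fin 3) ℝ).toBasis.linearIndependent
      rw [OrthonormalBasis.coe_toBasis] at h0
      have e : (fun k : Fin 3 => EuclideanSpace.single k (1 : ℝ)) = ⇑(EuclideanSpace.basisFun (Fin 3) ℝ) := by
        funext k
        exact (EuclideanSpace.basisFun_apply (Fin 3) ℝ k).symm
      rw [e]; exact h0
    exact (hb.map' (Dp : EuclideanSpace ℝ (Fin 3) →ₗ[ℝ] EuclideanSpace ℝ (Fin 4))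
      (LinearMap.ker_eq_bot.2 hinj))
  have key := det4_ne_zero_of_normal_frame (gradient (rho g) q.1) V hn hVn hli
  exact key

/-- **Sub-goal `helper_det4_beltChart_ne_zero` of stub `stub_T3_dualPresentation`** (T3 ▸ node `Hgap` ▸ part B
`helper_Hgap_twisting`, brick G2-3 sphere side I; wave 6, lead c5): the `det4`-orientation character of the
three-dimensional belt-tube chart `p ↦ (E (seam (β♭ (circlePt (p 2), L p)))).1` (any `rho`-preserving
diffeomorphism `E`, `L` the fibre part) never vanishes on `‖L p‖ < 1`. [cite: LeeSmoothManifolds2013, Prop. 15.24] -/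
theorem helper_det4_beltChart_ne_zero : ∀ (g : ℕ) (ι : Type) [Finite ι] (h : ι → Literature.Topology.FourManifolds.HandleAttachingMap 3 2 (Literature.Topology.FourManifolds.LefschetzBase.Base g)) (X : Type) [TopologicalSpace X] [ChartedSpace (EuclideanHalfSpace 4) X] [IsManifold (𝓡∂ 4) ∞ X] (D : Literature.Topology.FourManifolds.HandleAttachingMap.MultiAttachmentData h (𝓡∂ 4) X) (bX : Literature.Topology.FourManifolds.BoundaryData (𝓡∂ 4) X (𝓡 3)) (Ψ : bX.carrier ≃ₘ⟮𝓡 3, 𝓡 3⟯ (Literature.Topology.FourManifolds.LefschetzBase.bBase g).carrier) (E : Literature.Topology.FourManifolds.LefschetzBase.Base g ≃ₘ^∞⟮𝓡∂ 4, 𝓡∂ 4⟯ Literature.Topology.FourManifolds.LefschetzBase.Base g) (j : ι) (L : EuclideanSpace ℝ (Fin 3) →L[ℝ] EuclideanSpace ℝ (Fin 2)), (∀ (p : EuclideanSpace ℝ (Fin 3)) (i : Fin 2), L p i = p (Fin.castSucc i)) → (∀ x : Literature.Topology.FourManifolds.LefschetzBase.Base g, Literature.Topology.FourManifolds.LefschetzBase.rho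 g (E x).1 = Literature.Topology.FourManifolds.LefschetzBase.rho g x.1) → ∀ (p : EuclideanSpace ℝ (Fin 3)), ‖L p‖ < 1 → Literature.Geometry.Symplectic.det4 (gradient (Literature.Topology.FourManifolds.LefschetzBase.rho g) (E ((Literature.Topology.FourManifolds.BoundaryManifold.boundaryData 3 (Literature.Topology.FourManifolds.LefschetzBase.Base g)).incl (Summit.SmoothPoincare4.SmoothPoincare4.Theorems.AcyclicBisectionExists.ModpBraidOrbits.seamDiffeo bX (Literature.Topology.FourManifolds.LefschetzBase.bBase g) Ψ ((Summit.SmoothPoincare4.SmoothPoincare4.Theorems.AcyclicBisectionExists.ModpBraidOrbits.beltMap D j).boundaryTube.toHomeo (Literature.Topology.FourManifolds.circlePt (p 2), L p))))).1) (mfderiv 𝓘(ℝ, EuclideanSpace ℝ (Fin 3)) 𝓘(ℝ, EuclideanSpace ℝ (Fin 4)) (fun p : EuclideanSpace ℝ (Fin 3) => (E ((Literature.Topology.FourManifolds.BoundaryManifold.boundaryData 3 (Literature.Topology.FourManifolds.LefschetzBase.Base g)).incl (Summit.SmoothPoincare4.SmoothPoincare4.Theorems.AcyclicBisectionExists.ModpBraidOrbits.seamDiffeo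 bX (Literature.Topology.FourManifolds.LefschetzBase.bBase g) Ψ ((Summit.SmoothPoincare4.SmoothPoincare4.Theorems.AcyclicBisectionExists.ModpBraidOrbits.beltMap D j).boundaryTube.toHomeo (Literature.Topology.FourManifolds.circlePt (p 2), L p))))).1) p (EuclideanSpace.single (0 : Fin 3) (1 : ℝ))) (mfderiv 𝓘(ℝ, EuclideanSpace ℝ (Fin 3)) 𝓘(ℝ, EuclideanSpace ℝ (Fin 4)) (fun p : EuclideanSpace ℝ (Fin 3) => (E ((Literature.Topology.FourManifolds.BoundaryManifold.boundaryData 3 (Literature.Topology.FourManifolds.LefschetzBase.Base g)).incl (Summit.SmoothPoincare4.SmoothPoincare4.Theorems.AcyclicBisectionExists.ModpBraidOrbits.seamDiffeo bX (Literature.Topology.FourManifolds.LefschetzBase.bBase g) Ψ ((Summit.SmoothPoincare4.SmoothPoincare4.Theorems.AcyclicBisectionExists.ModpBraidOrbits.beltMap D j).boundaryTube.toHomeo (Literature.Topology.FourManifolds.circlePt (p 2), L p))))).1) p (EuclideanSpace.single (1 : Fin 3) (1 : ℝ))) (mfderiv 𝓘(ℝ, EuclideanSpace ℝ (Fin 3))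 𝓘(ℝ, EuclideanSpace ℝ (Fin 4)) (fun p : EuclideanSpace ℝ (Fin 3) => (E ((Literature.Topology.FourManifolds.BoundaryManifold.boundaryData 3 (Literature.Topology.FourManifolds.LefschetzBase.Base g)).incl (Summit.SmoothPoincare4.SmoothPoincare4.Theorems.AcyclicBisectionExists.ModpBraidOrbits.seamDiffeo bX (Literature.Topology.FourManifolds.LefschetzBase.bBase g) Ψ ((Summit.SmoothPoincare4.SmoothPoincare4.Theorems.AcyclicBisectionExists.ModpBraidOrbits.beltMap D j).boundaryTube.toHomeo (Literature.Topology.FourManifolds.circlePt (p 2), L p))))).1) p (EuclideanSpace.single (2 : Fin 3) (1 : ℝ))) ≠ 0 :=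
  fun _ _ _ _ _ _ _ _ D bX Ψ E j _ hL hEρ p hp => det4_beltChart₃_ne_zero D bX Ψ E j hL hEρ p hp

end Chart

end Summit.SmoothPoincare4.SmoothPoincare4.Theorems.AcyclicBisectionExists.ModpBraidOrbits

end
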